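import Literature.Analysis.FunctionSpaces.PolchinskiTameCalculus
import Literature.Analysis.FunctionSpaces.PolchinskiSemigroupJets
import HarnessLib

/-!
# Smoothed jets with weighted bounds: the atoms `E_P[G(y+ζ)]` of a `Ψ`-dominated `G`, their jet packs
# relative to the weight `Z = E_P[Ψ(y+ζ)]`, and the tame packs of `P_{0,t}F = W/Z` and `∂_kP_{0,t}F`
# (Bauerschmidt–Bodineau–Dagallier, Theorem 3, for initial potentials that are only bounded below)

Topic `Literature/Analysis/FunctionSpaces`; "proof architecture" file behind the named fact
`Polchinski.BauerschmidtBodineau_multiscaleBakryEmery` ([BBD] Theorem 3, `MultiscaleBakryEmery.lean`).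

After a restart of the Polchinski flow at a scale `s > 0` with `C_s ≻ 0`, the initial Boltzmann weight
`Ψ = e^{−V_s} = E_{C_s}[e^{−V₀}(·+η)]` of a potential `V₀` that is merely measurable and bounded below is
smooth, positive, bounded, but NOT bounded away from `0`; what survives (`PolchinskiSmoothedPotential.lean`)
is that every derivative of `Ψ` is dominated by powers `Ψ^{1−δ}` of `Ψ` itself, also after averaging over any
probability measure `P` («`Ψ`-domination»).  This file turns `Ψ`-domination into the input format of the
weighted calculus `PolchinskiTameCalculus.lean`:

* §1 closure of `Ψ`-domination under multiplication by a `C_b^M` function (`W = ΨF`) and under partial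
  derivatives (`∂_vΨ`, `∂_v(ΨF)`, …) — Leibniz' rule and `‖Dⁿ(∂_vG)‖ ≤ ‖v‖‖Dⁿ⁺¹G‖`;
* §2 for a `Ψ`-dominated `G ∈ C_b⁴` and a probability measure `P`, the JET PACK of the atom
  `y ↦ E_P[G(y+ζ)]` relative to the weight `Z(y) = E_P[Ψ(y+ζ)]` (derivatives `E_P[∇G(y+ζ)]`,
  `E_P[D²G(y+ζ)]`, sizes `≤ c_δ Z^{1−δ}`), and the third level;
* §3 positivity `0 < Z ≤ B`, `aZ ≤ W ≤ bZ`;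
* §4 sums and scalar multiples of packs, and the tame packs of `u = W/Z = P_{0,t}F` and of
  `∂_k u = (W_k − uZ_k)/Z` with the identification `∂_k u = (Du) e_k` ([BBD] proof of Prop 8 / Thm 3:
  `P_{0,t}F = W_t/Z_t`, p0015 L9–12, and its derivatives).

All statements are spelled out (no definitions, no new named facts); nothing here concerns Yang–Mills.

## References

* [BauerschmidtBodineauDagallier2023] R. Bauerschmidt, T. Bodineau, B. Dagallier, Probab. Surveys 21
  (2024) 200–290, arXiv:2307.07619 — Def 2 p0013, Prop 8 proof p0015 L9–32, Thm 3 proof p0016. READ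
  (held text `paper:arxiv-2307.07619`).
* [Rudin1976] W. Rudin, Principles of Mathematical Analysis — Thm 5.3 (Leibniz/product rules), 9.19.
-/

noncomputable section

-- nested operator-norm instances `E →L[ℝ] E →L[ℝ] E →L[ℝ] ℝ`
set_option maxSynthPendingDepth 4

open MeasureTheory ProbabilityTheory Filter Topology Set
open scoped RealInnerProductSpace Matrix MatrixOrder

namespace Literature.Analysis.FunctionSpaces

namespace Polchinski

variable {N : ℕ}

/-! ### Helpers -/

section Helpers

/-- A bounded continuous shift `ζ ↦ H(y+ζ)` is integrable for a finite measure. [folklore] -/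
private theorem integrable_shift' {Y : Type*} [NormedAddCommGroup Y] {H : EuclideanSpace ℝ (Fin N) → Y}
    (hHc : Continuous H) {MH : ℝ} (hH : ∀ x, ‖H x‖ ≤ MH) (P : Measure (EuclideanSpace ℝ (Fin N)))
    [IsFiniteMeasure P] (y : EuclideanSpace ℝ (Fin N)) : Integrable (fun ζ => H (y + ζ)) P :=
  Integrable.of_bound (hHc.comp (continuous_const.add continuous_id)).aestronglyMeasurable MH
    (Eventually.of_forall fun ζ => hH (y + ζ))

/-- `‖Dⁿ(∂_vG)(x)‖ ≤ ‖v‖ ‖Dⁿ⁺¹G(x)‖`. [cite: Rudin1976, Thm 9.19] -/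
theorem norm_iteratedFDeriv_partial_le {G : EuclideanSpace ℝ (Fin N) → ℝ} {M n : ℕ}
    (hG : ContDiff ℝ M G) (hn : n + 1 ≤ M) (v x : EuclideanSpace ℝ (Fin N)) :
    ‖iteratedFDeriv ℝ n (fun x => fderiv ℝ G x v) x‖ ≤ ‖v‖ * ‖iteratedFDeriv ℝ (n + 1) G x‖ := by
  have hfun : (fun x => fderiv ℝ G x v) = (ContinuousLinearMap.apply ℝ ℝ v) ∘ fderiv ℝ G := by
    funext x; simp [Function.comp]
  have hd : ContDiff ℝ n (fderiv ℝ G) := hG.fderiv_right (by exact_mod_cast hn)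
  have h := ContinuousLinearMap.norm_iteratedFDeriv_comp_left (ContinuousLinearMap.apply ℝ ℝ v)
    (x := x) (hd.contDiffAt) (le_refl (n : WithTop ℕ∞))
  rw [hfun]
  refine h.trans ?_
  rw [norm_iteratedFDeriv_fderiv]
  refine mul_le_mul_of_nonneg_right ?_ (norm_nonneg _)
  refine ContinuousLinearMap.opNorm_le_bound _ (norm_nonneg v) fun f => ?_
  rw [ContinuousLinearMap.apply_apply, mul_comm]
  exact f.le_opNorm v

end Helpers

/-! ### §1 `Ψ`-domination: closure under products with `C_b^M` functions and under partials -/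

section Dominated

variable {Ψ G F : EuclideanSpace ℝ (Fin N) → ℝ} {B BG BF : ℝ}

/-- From order-wise domination constants to one constant for all orders `n ≤ M`. [folklore] -/
private theorem dom_uniform (hΨ0 : ∀ x, 0 ≤ Ψ x) {M : ℕ}
    (hwG : ∀ n ≤ M, ∀ δ : ℝ, 0 < δ → ∃ c : ℝ, 0 ≤ c ∧
      ∀ (P : Measure (EuclideanSpace ℝ (Fin N))) [IsProbabilityMeasure P] (y : EuclideanSpace ℝ (Fin N)),
        ∫ ζ, ‖iteratedFDeriv ℝ n G (y + ζ)‖ ∂P ≤ c * (∫ ζ, Ψ (y + ζ) ∂P) ^ (1 - δ))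
    {δ : ℝ} (hδ : 0 < δ) :
    ∃ c : ℝ, 0 ≤ c ∧ ∀ n ≤ M,
      ∀ (P : Measure (EuclideanSpace ℝ (Fin N))) [IsProbabilityMeasure P] (y : EuclideanSpace ℝ (Fin N)),
        ∫ ζ, ‖iteratedFDeriv ℝ n G (y + ζ)‖ ∂P ≤ c * (∫ ζ, Ψ (y + ζ) ∂P) ^ (1 - δ) := by
  have h : ∀ i ∈ Finset.range (M + 1), ∃ c : ℝ, 0 ≤ c ∧
      ∀ (P : Measure (EuclideanSpace ℝ (Fin N))) [IsProbabilityMeasure P] (y : EuclideanSpace ℝ (Fin N)),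
        ∫ ζ, ‖iteratedFDeriv ℝ i G (y + ζ)‖ ∂P ≤ c * (∫ ζ, Ψ (y + ζ) ∂P) ^ (1 - δ) :=
    fun i hi => hwG i (by simpa [Finset.mem_range, Nat.lt_succ_iff] using hi) δ hδ
  choose! c hc0 hc using h
  refine ⟨∑ i ∈ Finset.range (M + 1), c i, Finset.sum_nonneg fun i hi => hc0 i hi, fun n hn P _ y => ?_⟩
  have hn' : n ∈ Finset.range (M + 1) := by simpa [Finset.mem_range, Nat.lt_succ_iff] using hn
  have hle : c n ≤ ∑ i ∈ Finset.range (M + 1), c i :=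
    Finset.single_le_sum (fun i hi => hc0 i hi) hn'
  have hZ0 : 0 ≤ (∫ ζ, Ψ (y + ζ) ∂P) ^ (1 - δ) :=
    Real.rpow_nonneg (integral_nonneg fun _ => hΨ0 _) _
  exact (hc n hn' P y).trans (mul_le_mul_of_nonneg_right hle hZ0)

/-- **`Ψ`-domination is inherited by partial derivatives**: if `G ∈ C^{M+1}` has bounded derivatives and
`E_P‖DⁿG(y+·)‖ ≤ c_δ Z_P(y)^{1−δ}` (`Z_P(y) = E_P[Ψ(y+·)]`) for `n ≤ M+1`, then `∂_vG ∈ C^M` has the same two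
properties for `n ≤ M` (constants multiplied by `‖v‖`). [cite: Rudin1976, Thm 9.19] -/
theorem dominated_partial {M : ℕ} (hG : ContDiff ℝ ((M + 1 : ℕ) : WithTop ℕ∞) G)
    (hBG : ∀ n ≤ M + 1, ∀ x, ‖iteratedFDeriv ℝ n G x‖ ≤ BG)
    (hwG : ∀ n ≤ M + 1, ∀ δ : ℝ, 0 < δ → ∃ c : ℝ, 0 ≤ c ∧
      ∀ (P : Measure (EuclideanSpace ℝ (Fin N))) [IsProbabilityMeasure P] (y : EuclideanSpace ℝ (Fin N)),
        ∫ ζ, ‖iteratedFDeriv ℝ n G (y + ζ)‖ ∂P ≤ c * (∫ ζ, Ψ (y + ζ) ∂P) ^ (1 - δ))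
    (v : EuclideanSpace ℝ (Fin N)) :
    ContDiff ℝ M (fun x => fderiv ℝ G x v) ∧
    (∀ n ≤ M, ∀ x, ‖iteratedFDeriv ℝ n (fun x => fderiv ℝ G x v) x‖ ≤ ‖v‖ * BG) ∧
    (∀ n ≤ M, ∀ δ : ℝ, 0 < δ → ∃ c : ℝ, 0 ≤ c ∧
      ∀ (P : Measure (EuclideanSpace ℝ (Fin N))) [IsProbabilityMeasure P] (y : EuclideanSpace ℝ (Fin N)),
        ∫ ζ, ‖iteratedFDeriv ℝ n (fun x => fderiv ℝ G x v) (y + ζ)‖ ∂P ≤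
          c * (∫ ζ, Ψ (y + ζ) ∂P) ^ (1 - δ)) := by
  have hd : ContDiff ℝ M (fderiv ℝ G) := hG.fderiv_right (by push_cast; exact le_rfl)
  have hdv : ContDiff ℝ M (fun x => fderiv ℝ G x v) := hd.clm_apply contDiff_const
  have hpt : ∀ n ≤ M, ∀ x, ‖iteratedFDeriv ℝ n (fun x => fderiv ℝ G x v) x‖ ≤
      ‖v‖ * ‖iteratedFDeriv ℝ (n + 1) G x‖ :=
    fun n hn x => norm_iteratedFDeriv_partial_le (M := M + 1) hG (by omega) v x
  refine ⟨hdv, fun n hn x => (hpt n hn x).trans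
    (mul_le_mul_of_nonneg_left (hBG (n + 1) (by omega) x) (norm_nonneg _)), fun n hn δ hδ => ?_⟩
  obtain ⟨c, hc0, hc⟩ := hwG (n + 1) (by omega) δ hδ
  refine ⟨‖v‖ * c, mul_nonneg (norm_nonneg _) hc0, fun P _ y => ?_⟩
  have hc1 : Continuous fun x => iteratedFDeriv ℝ n (fun x => fderiv ℝ G x v) x :=
    hdv.continuous_iteratedFDeriv (by exact_mod_cast hn)
  have hc2 : Continuous fun x => iteratedFDeriv ℝ (n + 1) G x :=
    hG.continuous_iteratedFDeriv (by exact_mod_cast (Nat.succ_le_succ hn))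
  have hI1 : Integrable (fun ζ => ‖iteratedFDeriv ℝ n (fun x => fderiv ℝ G x v) (y + ζ)‖) P :=
    (integrable_shift' hc1 (fun x => (hpt n hn x).trans
      (mul_le_mul_of_nonneg_left (hBG (n + 1) (by omega) x) (norm_nonneg _))) P y).norm
  have hI2 : Integrable (fun ζ => ‖v‖ * ‖iteratedFDeriv ℝ (n + 1) G (y + ζ)‖) P :=
    ((integrable_shift' hc2 (hBG (n + 1) (by omega)) P y).norm).const_mul _
  calc ∫ ζ, ‖iteratedFDeriv ℝ n (fun x => fderiv ℝ G x v) (y + ζ)‖ ∂P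
      ≤ ∫ ζ, ‖v‖ * ‖iteratedFDeriv ℝ (n + 1) G (y + ζ)‖ ∂P :=
        integral_mono hI1 hI2 fun ζ => hpt n hn (y + ζ)
    _ = ‖v‖ * ∫ ζ, ‖iteratedFDeriv ℝ (n + 1) G (y + ζ)‖ ∂P := integral_const_mul _ _
    _ ≤ ‖v‖ * (c * (∫ ζ, Ψ (y + ζ) ∂P) ^ (1 - δ)) :=
        mul_le_mul_of_nonneg_left (hc P y) (norm_nonneg _)
    _ = ‖v‖ * c * (∫ ζ, Ψ (y + ζ) ∂P) ^ (1 - δ) := by ring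

/-- **`Ψ`-domination is inherited by products with `C_b^M` functions** (`W`-atoms `e^{−V}F`): Leibniz'
rule `‖Dⁿ(ΨF)‖ ≤ Σ_i C(n,i)‖DⁱΨ‖‖Dⁿ⁻ⁱF‖ ≤ 2ⁿ B B_F`, and after averaging `≤ c_δ Z^{1−δ}`.
[cite: Rudin1976, Thm 5.3] -/
theorem dominated_mul (hΨ0 : ∀ x, 0 ≤ Ψ x) {M : ℕ} (hΨ : ContDiff ℝ M Ψ)
    (hB : ∀ n ≤ M, ∀ x, ‖iteratedFDeriv ℝ n Ψ x‖ ≤ B)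
    (hw : ∀ n ≤ M, ∀ δ : ℝ, 0 < δ → ∃ c : ℝ, 0 ≤ c ∧
      ∀ (P : Measure (EuclideanSpace ℝ (Fin N))) [IsProbabilityMeasure P] (y : EuclideanSpace ℝ (Fin N)),
        ∫ ζ, ‖iteratedFDeriv ℝ n Ψ (y + ζ)‖ ∂P ≤ c * (∫ ζ, Ψ (y + ζ) ∂P) ^ (1 - δ))
    (hF : ContDiff ℝ M F) (hFB : ∀ n ≤ M, ∀ x, ‖iteratedFDeriv ℝ n F x‖ ≤ BF) :
    ContDiff ℝ M (fun x => Ψ x * F x) ∧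
    (∀ n ≤ M, ∀ x, ‖iteratedFDeriv ℝ n (fun x => Ψ x * F x) x‖ ≤ 2 ^ M * B * BF) ∧
    (∀ n ≤ M, ∀ δ : ℝ, 0 < δ → ∃ c : ℝ, 0 ≤ c ∧
      ∀ (P : Measure (EuclideanSpace ℝ (Fin N))) [IsProbabilityMeasure P] (y : EuclideanSpace ℝ (Fin N)),
        ∫ ζ, ‖iteratedFDeriv ℝ n (fun x => Ψ x * F x) (y + ζ)‖ ∂P ≤ c * (∫ ζ, Ψ (y + ζ) ∂P) ^ (1 - δ)) := by
  obtain ⟨x0⟩ : Nonempty (EuclideanSpace ℝ (Fin N)) := ⟨0⟩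
  have hB0 : 0 ≤ B := le_trans (norm_nonneg _) (hB 0 (Nat.zero_le _) x0)
  have hBF0 : 0 ≤ BF := le_trans (norm_nonneg _) (hFB 0 (Nat.zero_le _) x0)
  have hprod : ContDiff ℝ M (fun x => Ψ x * F x) := hΨ.mul hF
  -- Leibniz, pointwise
  have hLeib : ∀ n ≤ M, ∀ x, ‖iteratedFDeriv ℝ n (fun x => Ψ x * F x) x‖ ≤
      ∑ i ∈ Finset.range (n + 1), (n.choose i : ℝ) * BF * ‖iteratedFDeriv ℝ i Ψ x‖ := by
    intro n hn x
    have h := norm_iteratedFDeriv_mul_le (n := n) (N := M) hΨ hF x (by exact_mod_cast hn)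
    refine h.trans (Finset.sum_le_sum fun i hi => ?_)
    rw [Finset.mem_range] at hi
    calc (n.choose i : ℝ) * ‖iteratedFDeriv ℝ i Ψ x‖ * ‖iteratedFDeriv ℝ (n - i) F x‖
        ≤ (n.choose i : ℝ) * ‖iteratedFDeriv ℝ i Ψ x‖ * BF :=
          mul_le_mul_of_nonneg_left (hFB (n - i) (by omega) x) (by positivity)
      _ = (n.choose i : ℝ) * BF * ‖iteratedFDeriv ℝ i Ψ x‖ := by ring
  have hsum : ∀ n : ℕ, ∑ i ∈ Finset.range (n + 1), (n.choose i : ℝ) = 2 ^ n := fun n => by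
    have := Nat.sum_range_choose n
    exact_mod_cast this
  refine ⟨hprod, fun n hn x => ?_, fun n hn δ hδ => ?_⟩
  · refine (hLeib n hn x).trans ?_
    calc ∑ i ∈ Finset.range (n + 1), (n.choose i : ℝ) * BF * ‖iteratedFDeriv ℝ i Ψ x‖
        ≤ ∑ i ∈ Finset.range (n + 1), (n.choose i : ℝ) * BF * B :=
          Finset.sum_le_sum fun i hi => by
            rw [Finset.mem_range] at hi
            exact mul_le_mul_of_nonneg_left (hB i (by omega) x) (by positivity)
      _ = 2 ^ n * B * BF := by rw [← Finset.sum_mul, ← Finset.sum_mul, hsum]; ring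
      _ ≤ 2 ^ M * B * BF := by
          have h2 : (2 : ℝ) ^ n ≤ 2 ^ M := pow_le_pow_right₀ (by norm_num) hn
          exact mul_le_mul_of_nonneg_right (mul_le_mul_of_nonneg_right h2 hB0) hBF0
  · obtain ⟨c, hc0, hc⟩ := dom_uniform (G := Ψ) hΨ0 hw hδ
    refine ⟨2 ^ M * BF * c, by positivity, fun P _ y => ?_⟩
    have hcn : Continuous fun x => iteratedFDeriv ℝ n (fun x => Ψ x * F x) x :=
      hprod.continuous_iteratedFDeriv (by exact_mod_cast hn)
    have hci : ∀ i ≤ M, Continuous fun x => iteratedFDeriv ℝ i Ψ x := fun i hi =>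
      hΨ.continuous_iteratedFDeriv (by exact_mod_cast hi)
    have hbn : ∀ x, ‖iteratedFDeriv ℝ n (fun x => Ψ x * F x) x‖ ≤ 2 ^ n * B * BF := fun x => by
      refine (hLeib n hn x).trans ?_
      calc ∑ i ∈ Finset.range (n + 1), (n.choose i : ℝ) * BF * ‖iteratedFDeriv ℝ i Ψ x‖
          ≤ ∑ i ∈ Finset.range (n + 1), (n.choose i : ℝ) * BF * B :=
            Finset.sum_le_sum fun i hi => by
              rw [Finset.mem_range] at hi
              exact mul_le_mul_of_nonneg_left (hB i (by omega) x) (by positivity)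
        _ = 2 ^ n * B * BF := by rw [← Finset.sum_mul, ← Finset.sum_mul, hsum]; ring
    have hI1 : Integrable (fun ζ => ‖iteratedFDeriv ℝ n (fun x => Ψ x * F x) (y + ζ)‖) P :=
      (integrable_shift' hcn hbn P y).norm
    have hIi : ∀ i ∈ Finset.range (n + 1),
        Integrable (fun ζ => (n.choose i : ℝ) * BF * ‖iteratedFDeriv ℝ i Ψ (y + ζ)‖) P := by
      intro i hi
      rw [Finset.mem_range] at hi
      exact ((integrable_shift' (hci i (by omega)) (hB i (by omega)) P y).norm).const_mul _
    have hI2 : Integrable (fun ζ => ∑ i ∈ Finset.range (n + 1),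
        (n.choose i : ℝ) * BF * ‖iteratedFDeriv ℝ i Ψ (y + ζ)‖) P := integrable_finsetSum _ hIi
    have hZ0 : 0 ≤ (∫ ζ, Ψ (y + ζ) ∂P) ^ (1 - δ) :=
      Real.rpow_nonneg (integral_nonneg fun _ => hΨ0 _) _
    calc ∫ ζ, ‖iteratedFDeriv ℝ n (fun x => Ψ x * F x) (y + ζ)‖ ∂P
        ≤ ∫ ζ, ∑ i ∈ Finset.range (n + 1), (n.choose i : ℝ) * BF * ‖iteratedFDeriv ℝ i Ψ (y + ζ)‖ ∂P :=
          integral_mono hI1 hI2 fun ζ => hLeib n hn (y + ζ)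
      _ = ∑ i ∈ Finset.range (n + 1), (n.choose i : ℝ) * BF * ∫ ζ, ‖iteratedFDeriv ℝ i Ψ (y + ζ)‖ ∂P := by
          rw [integral_finsetSum _ hIi]
          exact Finset.sum_congr rfl fun i _ => integral_const_mul _ _
      _ ≤ ∑ i ∈ Finset.range (n + 1), (n.choose i : ℝ) * BF * (c * (∫ ζ, Ψ (y + ζ) ∂P) ^ (1 - δ)) :=
          Finset.sum_le_sum fun i hi => by
            rw [Finset.mem_range] at hi
            exact mul_le_mul_of_nonneg_left (hc i (by omega) P y) (by positivity)
      _ = 2 ^ n * BF * c * (∫ ζ, Ψ (y + ζ) ∂P) ^ (1 - δ) := by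
          rw [← Finset.sum_mul, ← Finset.sum_mul, hsum]; ring
      _ ≤ 2 ^ M * BF * c * (∫ ζ, Ψ (y + ζ) ∂P) ^ (1 - δ) := by
          have h2 : (2 : ℝ) ^ n ≤ 2 ^ M := pow_le_pow_right₀ (by norm_num) hn
          exact mul_le_mul_of_nonneg_right
            (mul_le_mul_of_nonneg_right (mul_le_mul_of_nonneg_right h2 hBF0) hc0) hZ0

end Dominated

/-! ### §2 Jet packs of the atoms `y ↦ E_P[G(y+ζ)]` of a `Ψ`-dominated `G ∈ C_b⁴` -/

section Atoms

variable {Ψ G : EuclideanSpace ℝ (Fin N) → ℝ} {BG : ℝ}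

/-- **The jet pack of a smoothed atom relative to the weight `Z = E_P[Ψ(·+ζ)]`**: for a `Ψ`-dominated
`G ∈ C_b⁴` and a probability measure `P`, the atom `y ↦ E_P[G(y+ζ)]` has derivatives `E_P[∇G(y+ζ)]`,
`E_P[D²G(y+ζ)]` and all three have size `≤ c_δ Z(y)^{1−δ}` for every `δ > 0` (`‖E_P[DⁿG(y+·)]‖ ≤
E_P‖DⁿG(y+·)‖`).  For `G ∈ {e^{−V}, e^{−V}F, ∂e^{−V}, …}` these are the jets `Z_t, W_t, ∂Z_t, …` of [BBD]'s
proof of Prop 8 / Thm 3 when `V` is only bounded below. [cite: BauerschmidtBodineauDagallier2023, Proposition 8 (proof)] -/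
theorem sm_jpack (hG : ContDiff ℝ 4 G) (hBG : ∀ n ≤ 4, ∀ x, ‖iteratedFDeriv ℝ n G x‖ ≤ BG)
    (P : Measure (EuclideanSpace ℝ (Fin N))) [IsProbabilityMeasure P]
    (hwG : ∀ n ≤ 4, ∀ δ : ℝ, 0 < δ → ∃ c : ℝ, 0 ≤ c ∧
      ∀ (P : Measure (EuclideanSpace ℝ (Fin N))) [IsProbabilityMeasure P] (y : EuclideanSpace ℝ (Fin N)),
        ∫ ζ, ‖iteratedFDeriv ℝ n G (y + ζ)‖ ∂P ≤ c * (∫ ζ, Ψ (y + ζ) ∂P) ^ (1 - δ)) :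
    (∀ y, HasFDerivAt (fun y => ∫ ζ, G (y + ζ) ∂P) (∫ ζ, fderiv ℝ G (y + ζ) ∂P) y) ∧
    (∀ y, HasFDerivAt (fun y => ∫ ζ, fderiv ℝ G (y + ζ) ∂P)
      (∫ ζ, fderiv ℝ (fderiv ℝ G) (y + ζ) ∂P) y) ∧
    (∀ δ : ℝ, 0 < δ → ∃ c : ℝ, 0 ≤ c ∧ ∀ y,
      |∫ ζ, G (y + ζ) ∂P| ≤ c * (∫ ζ, Ψ (y + ζ) ∂P) ^ (1 - δ)) ∧
    (∀ δ : ℝ, 0 < δ → ∃ c : ℝ, 0 ≤ c ∧ ∀ y,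
      ‖∫ ζ, fderiv ℝ G (y + ζ) ∂P‖ ≤ c * (∫ ζ, Ψ (y + ζ) ∂P) ^ (1 - δ)) ∧
    (∀ δ : ℝ, 0 < δ → ∃ c : ℝ, 0 ≤ c ∧ ∀ y,
      ‖∫ ζ, fderiv ℝ (fderiv ℝ G) (y + ζ) ∂P‖ ≤ c * (∫ ζ, Ψ (y + ζ) ∂P) ^ (1 - δ)) := by
  obtain ⟨h1, h2, -, -, -, -⟩ := sm_pack hG hBG P
  refine ⟨h1, h2, fun δ hδ => ?_, fun δ hδ => ?_, fun δ hδ => ?_⟩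
  · obtain ⟨c, hc0, hc⟩ := hwG 0 (by norm_num) δ hδ
    refine ⟨c, hc0, fun y => ?_⟩
    rw [← Real.norm_eq_abs]
    refine (norm_integral_le_integral_norm _).trans ?_
    have he : (fun ζ => ‖G (y + ζ)‖) = fun ζ => ‖iteratedFDeriv ℝ 0 G (y + ζ)‖ :=
      funext fun ζ => (norm_iteratedFDeriv_zero (𝕜 := ℝ) (f := G) (x := y + ζ)).symm
    rw [he]
    exact hc P y
  · obtain ⟨c, hc0, hc⟩ := hwG 1 (by norm_num) δ hδ
    refine ⟨c, hc0, fun y => ?_⟩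
    refine (norm_integral_le_integral_norm _).trans ?_
    have he : (fun ζ => ‖fderiv ℝ G (y + ζ)‖) = fun ζ => ‖iteratedFDeriv ℝ 1 G (y + ζ)‖ :=
      funext fun ζ => Cb4.norm_fderiv_eq_norm_iteratedFDeriv_one G (y + ζ)
    rw [he]
    exact hc P y
  · obtain ⟨c, hc0, hc⟩ := hwG 2 (by norm_num) δ hδ
    refine ⟨c, hc0, fun y => ?_⟩
    refine (norm_integral_le_integral_norm _).trans ?_
    have he : (fun ζ => ‖fderiv ℝ (fderiv ℝ G) (y + ζ)‖) = fun ζ => ‖iteratedFDeriv ℝ 2 G (y + ζ)‖ :=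
      funext fun ζ => Cb4.norm_fderiv₂_eq_norm_iteratedFDeriv_two G (y + ζ)
    rw [he]
    exact hc P y

/-- **Third level of the atom**: `∇_y E_P[D²G(y+ζ)] = E_P[D³G(y+ζ)]`, of size `≤ c_δ Z^{1−δ}`.
[cite: BauerschmidtBodineauDagallier2023, Lemma 1 (proof)] -/
theorem sm_jet₃ (hG : ContDiff ℝ 4 G) (hBG : ∀ n ≤ 4, ∀ x, ‖iteratedFDeriv ℝ n G x‖ ≤ BG)
    (P : Measure (EuclideanSpace ℝ (Fin N))) [IsProbabilityMeasure P]
    (hwG : ∀ n ≤ 4, ∀ δ : ℝ, 0 < δ → ∃ c : ℝ, 0 ≤ c ∧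
      ∀ (P : Measure (EuclideanSpace ℝ (Fin N))) [IsProbabilityMeasure P] (y : EuclideanSpace ℝ (Fin N)),
        ∫ ζ, ‖iteratedFDeriv ℝ n G (y + ζ)‖ ∂P ≤ c * (∫ ζ, Ψ (y + ζ) ∂P) ^ (1 - δ)) :
    (∀ y, HasFDerivAt (fun y => ∫ ζ, fderiv ℝ (fderiv ℝ G) (y + ζ) ∂P)
      (∫ ζ, fderiv ℝ (fderiv ℝ (fderiv ℝ G)) (y + ζ) ∂P) y) ∧
    (∀ δ : ℝ, 0 < δ → ∃ c : ℝ, 0 ≤ c ∧ ∀ y,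
      ‖∫ ζ, fderiv ℝ (fderiv ℝ (fderiv ℝ G)) (y + ζ) ∂P‖ ≤ c * (∫ ζ, Ψ (y + ζ) ∂P) ^ (1 - δ)) := by
  refine ⟨fun y => hasFDerivAt_integral_shift (Cb4.hasFDerivAt_fderiv₂ hG)
    (atom_continuous hG hBG).2.2.2 (Cb4.norm_fderiv₂_le hBG) (Cb4.norm_fderiv₃_le hBG) P y,
    fun δ hδ => ?_⟩
  obtain ⟨c, hc0, hc⟩ := hwG 3 (by norm_num) δ hδ
  refine ⟨c, hc0, fun y => ?_⟩
  refine (norm_integral_le_integral_norm _).trans ?_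
  have he : (fun ζ => ‖fderiv ℝ (fderiv ℝ (fderiv ℝ G)) (y + ζ)‖) =
      fun ζ => ‖iteratedFDeriv ℝ 3 G (y + ζ)‖ :=
    funext fun ζ => Cb4.norm_fderiv₃_eq_norm_iteratedFDeriv_three G (y + ζ)
  rw [he]
  exact hc P y

end Atoms

/-! ### §3 Positivity of the weight and the two-sided bound `aZ ≤ W ≤ bZ` -/

section Positivity

variable {Ψ F : EuclideanSpace ℝ (Fin N) → ℝ} {B a b : ℝ}

/-- `0 < E_P[Ψ(y+ζ)]` for continuous `0 < Ψ ≤ B`. [cite: BauerschmidtBodineauDagallier2023, Definition 2] -/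
theorem smZ_pos (hΨc : Continuous Ψ) (hpos : ∀ x, 0 < Ψ x) (hΨB : ∀ x, Ψ x ≤ B)
    (P : Measure (EuclideanSpace ℝ (Fin N))) [IsProbabilityMeasure P] (y : EuclideanSpace ℝ (Fin N)) :
    0 < ∫ ζ, Ψ (y + ζ) ∂P := by
  have hint : Integrable (fun ζ => Ψ (y + ζ)) P :=
    integrable_shift' hΨc (fun x => by
      rw [Real.norm_eq_abs, abs_of_pos (hpos x)]; exact hΨB x) P y
  rw [integral_pos_iff_support_of_nonneg (fun ζ => (hpos _).le) hint]
  have hsupp : Function.support (fun ζ => Ψ (y + ζ)) = univ := by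
    ext ζ; simp [(hpos (y + ζ)).ne']
  rw [hsupp, measure_univ]; exact one_pos

/-- `E_P[Ψ(y+ζ)] ≤ B`. [cite: BauerschmidtBodineauDagallier2023, Definition 2] -/
theorem smZ_le (hΨc : Continuous Ψ) (hpos : ∀ x, 0 < Ψ x) (hΨB : ∀ x, Ψ x ≤ B)
    (P : Measure (EuclideanSpace ℝ (Fin N))) [IsProbabilityMeasure P] (y : EuclideanSpace ℝ (Fin N)) :
    ∫ ζ, Ψ (y + ζ) ∂P ≤ B := by
  have hint : Integrable (fun ζ => Ψ (y + ζ)) P :=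
    integrable_shift' hΨc (fun x => by
      rw [Real.norm_eq_abs, abs_of_pos (hpos x)]; exact hΨB x) P y
  have h := integral_mono hint (integrable_const B) fun ζ => hΨB (y + ζ)
  simpa using h

/-- **`aZ ≤ W ≤ bZ`** for `W = E_P[Ψ F(y+·)]`, `a ≤ F ≤ b`, `Ψ > 0` (so `a ≤ P_{0,t}F ≤ b`,
«`F_t` takes values in `I`», [BBD] p0016 L43). [cite: BauerschmidtBodineauDagallier2023, Theorem 3 (proof)] -/
theorem smW_mem (hΨc : Continuous Ψ) (hpos : ∀ x, 0 < Ψ x) (hΨB : ∀ x, Ψ x ≤ B) (hFc : Continuous F)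
    (hab : ∀ x, a ≤ F x ∧ F x ≤ b)
    (P : Measure (EuclideanSpace ℝ (Fin N))) [IsProbabilityMeasure P] (y : EuclideanSpace ℝ (Fin N)) :
    a * (∫ ζ, Ψ (y + ζ) ∂P) ≤ ∫ ζ, Ψ (y + ζ) * F (y + ζ) ∂P ∧
      ∫ ζ, Ψ (y + ζ) * F (y + ζ) ∂P ≤ b * (∫ ζ, Ψ (y + ζ) ∂P) := by
  obtain ⟨x0⟩ : Nonempty (EuclideanSpace ℝ (Fin N)) := ⟨0⟩
  have hΨabs : ∀ x, ‖Ψ x‖ ≤ B := fun x => by rw [Real.norm_eq_abs, abs_of_pos (hpos x)]; exact hΨB x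
  have hB0 : 0 ≤ B := (norm_nonneg _).trans (hΨabs x0)
  set M : ℝ := max |a| |b| with hM
  have hFabs : ∀ x, |F x| ≤ M := fun x =>
    abs_le.2 ⟨by linarith [(hab x).1, neg_abs_le a, le_max_left |a| |b|],
      by linarith [(hab x).2, le_abs_self b, le_max_right |a| |b|]⟩
  have hintZ : Integrable (fun ζ => Ψ (y + ζ)) P := integrable_shift' hΨc hΨabs P y
  have hintW : Integrable (fun ζ => Ψ (y + ζ) * F (y + ζ)) P :=
    integrable_shift' (H := fun x => Ψ x * F x) (hΨc.mul hFc) (MH := B * M) (fun x => by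
      rw [norm_mul, Real.norm_eq_abs (F x)]
      exact mul_le_mul (hΨabs x) (hFabs x) (abs_nonneg _) hB0) P y
  constructor
  · have h := integral_mono (hintZ.const_mul a) hintW fun ζ => by
      show a * Ψ (y + ζ) ≤ Ψ (y + ζ) * F (y + ζ)
      rw [mul_comm]; exact mul_le_mul_of_nonneg_left (hab _).1 (hpos _).le
    rwa [integral_const_mul] at h
  · have h := integral_mono hintW (hintZ.const_mul b) fun ζ => by
      show Ψ (y + ζ) * F (y + ζ) ≤ b * Ψ (y + ζ)
      rw [mul_comm b]; exact mul_le_mul_of_nonneg_left (hab _).2 (hpos _).le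
    rwa [integral_const_mul] at h

end Positivity

/-! ### §4 Pack algebra (sums, scalar multiples) and the tame packs of `u = W/Z`, `∂_k u`, `(∇u)²_Ċ`,
`(∇√u)²_Ċ` -/

section Packs

variable {Z : EuclideanSpace ℝ (Fin N) → ℝ} {K₀ : ℝ}
  {f g : EuclideanSpace ℝ (Fin N) → ℝ}
  {f1 g1 : EuclideanSpace ℝ (Fin N) → EuclideanSpace ℝ (Fin N) →L[ℝ] ℝ}
  {f2 g2 : EuclideanSpace ℝ (Fin N) → EuclideanSpace ℝ (Fin N) →L[ℝ] EuclideanSpace ℝ (Fin N) →L[ℝ] ℝ}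

/-- Scalar multiples of tame sizes. [folklore] -/
private theorem tame_const_mul' (c : ℝ) {σ σ' : EuclideanSpace ℝ (Fin N) → ℝ}
    (h : ∀ δ : ℝ, 0 < δ → ∃ c₀ : ℝ, 0 ≤ c₀ ∧ ∀ x, σ x ≤ c₀ * Z x ^ (-δ))
    (hle : ∀ x, σ' x ≤ |c| * σ x) :
    ∀ δ : ℝ, 0 < δ → ∃ c₀ : ℝ, 0 ≤ c₀ ∧ ∀ x, σ' x ≤ c₀ * Z x ^ (-δ) := by
  intro δ hδ
  obtain ⟨c₀, hc₀, h⟩ := h δ hδ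
  refine ⟨|c| * c₀, by positivity, fun x => (hle x).trans ?_⟩
  rw [mul_assoc]
  exact mul_le_mul_of_nonneg_left (h x) (abs_nonneg c)

/-- Scalar multiples of jet sizes. [folklore] -/
private theorem jet_const_mul' (c : ℝ) {σ σ' : EuclideanSpace ℝ (Fin N) → ℝ}
    (h : ∀ δ : ℝ, 0 < δ → ∃ c₀ : ℝ, 0 ≤ c₀ ∧ ∀ x, σ x ≤ c₀ * Z x ^ (1 - δ))
    (hle : ∀ x, σ' x ≤ |c| * σ x) :
    ∀ δ : ℝ, 0 < δ → ∃ c₀ : ℝ, 0 ≤ c₀ ∧ ∀ x, σ' x ≤ c₀ * Z x ^ (1 - δ) := by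
  intro δ hδ
  obtain ⟨c₀, hc₀, h⟩ := h δ hδ
  refine ⟨|c| * c₀, by positivity, fun x => (hle x).trans ?_⟩
  rw [mul_assoc]
  exact mul_le_mul_of_nonneg_left (h x) (abs_nonneg c)

/-- **Scalar multiple of a tame pack.** [cite: Rudin1976, Thm 5.3] -/
theorem tpack_const_mul (c : ℝ)
    (hf : (∀ x, HasFDerivAt f (f1 x) x) ∧ (∀ x, HasFDerivAt f1 (f2 x) x) ∧
      (∀ δ : ℝ, 0 < δ → ∃ c : ℝ, 0 ≤ c ∧ ∀ x, |f x| ≤ c * Z x ^ (-δ)) ∧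
      (∀ δ : ℝ, 0 < δ → ∃ c : ℝ, 0 ≤ c ∧ ∀ x, ‖f1 x‖ ≤ c * Z x ^ (-δ)) ∧
      (∀ δ : ℝ, 0 < δ → ∃ c : ℝ, 0 ≤ c ∧ ∀ x, ‖f2 x‖ ≤ c * Z x ^ (-δ))) :
    (∀ x, HasFDerivAt (fun x => c * f x) (c • f1 x) x) ∧
    (∀ x, HasFDerivAt (fun x => c • f1 x) (c • f2 x) x) ∧
    (∀ δ : ℝ, 0 < δ → ∃ c₀ : ℝ, 0 ≤ c₀ ∧ ∀ x, |c * f x| ≤ c₀ * Z x ^ (-δ)) ∧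
    (∀ δ : ℝ, 0 < δ → ∃ c₀ : ℝ, 0 ≤ c₀ ∧ ∀ x, ‖c • f1 x‖ ≤ c₀ * Z x ^ (-δ)) ∧
    (∀ δ : ℝ, 0 < δ → ∃ c₀ : ℝ, 0 ≤ c₀ ∧ ∀ x, ‖c • f2 x‖ ≤ c₀ * Z x ^ (-δ)) := by
  obtain ⟨hf1, hf2, hf0b, hf1b, hf2b⟩ := hf
  exact ⟨fun x => (hf1 x).const_smul c, fun x => (hf2 x).const_smul c,
    tame_const_mul' c hf0b (fun x => (abs_mul _ _).le),
    tame_const_mul' c hf1b (fun x => by rw [norm_smul, Real.norm_eq_abs]),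
    tame_const_mul' c hf2b (fun x => by rw [norm_smul, Real.norm_eq_abs])⟩

/-- **Scalar multiple of a jet pack.** [cite: Rudin1976, Thm 5.3] -/
theorem jpack_const_mul (c : ℝ)
    (hf : (∀ x, HasFDerivAt f (f1 x) x) ∧ (∀ x, HasFDerivAt f1 (f2 x) x) ∧
      (∀ δ : ℝ, 0 < δ → ∃ c : ℝ, 0 ≤ c ∧ ∀ x, |f x| ≤ c * Z x ^ (1 - δ)) ∧
      (∀ δ : ℝ, 0 < δ → ∃ c : ℝ, 0 ≤ c ∧ ∀ x, ‖f1 x‖ ≤ c * Z x ^ (1 - δ)) ∧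
      (∀ δ : ℝ, 0 < δ → ∃ c : ℝ, 0 ≤ c ∧ ∀ x, ‖f2 x‖ ≤ c * Z x ^ (1 - δ))) :
    (∀ x, HasFDerivAt (fun x => c * f x) (c • f1 x) x) ∧
    (∀ x, HasFDerivAt (fun x => c • f1 x) (c • f2 x) x) ∧
    (∀ δ : ℝ, 0 < δ → ∃ c₀ : ℝ, 0 ≤ c₀ ∧ ∀ x, |c * f x| ≤ c₀ * Z x ^ (1 - δ)) ∧
    (∀ δ : ℝ, 0 < δ → ∃ c₀ : ℝ, 0 ≤ c₀ ∧ ∀ x, ‖c • f1 x‖ ≤ c₀ * Z x ^ (1 - δ)) ∧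
    (∀ δ : ℝ, 0 < δ → ∃ c₀ : ℝ, 0 ≤ c₀ ∧ ∀ x, ‖c • f2 x‖ ≤ c₀ * Z x ^ (1 - δ)) := by
  obtain ⟨hf1, hf2, hf0b, hf1b, hf2b⟩ := hf
  exact ⟨fun x => (hf1 x).const_smul c, fun x => (hf2 x).const_smul c,
    jet_const_mul' c hf0b (fun x => (abs_mul _ _).le),
    jet_const_mul' c hf1b (fun x => by rw [norm_smul, Real.norm_eq_abs]),
    jet_const_mul' c hf2b (fun x => by rw [norm_smul, Real.norm_eq_abs])⟩

/-- **Sum of jet packs.** [cite: Rudin1976, Thm 5.3] -/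
theorem jpack_add
    (hf : (∀ x, HasFDerivAt f (f1 x) x) ∧ (∀ x, HasFDerivAt f1 (f2 x) x) ∧
      (∀ δ : ℝ, 0 < δ → ∃ c : ℝ, 0 ≤ c ∧ ∀ x, |f x| ≤ c * Z x ^ (1 - δ)) ∧
      (∀ δ : ℝ, 0 < δ → ∃ c : ℝ, 0 ≤ c ∧ ∀ x, ‖f1 x‖ ≤ c * Z x ^ (1 - δ)) ∧
      (∀ δ : ℝ, 0 < δ → ∃ c : ℝ, 0 ≤ c ∧ ∀ x, ‖f2 x‖ ≤ c * Z x ^ (1 - δ)))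
    (hg : (∀ x, HasFDerivAt g (g1 x) x) ∧ (∀ x, HasFDerivAt g1 (g2 x) x) ∧
      (∀ δ : ℝ, 0 < δ → ∃ c : ℝ, 0 ≤ c ∧ ∀ x, |g x| ≤ c * Z x ^ (1 - δ)) ∧
      (∀ δ : ℝ, 0 < δ → ∃ c : ℝ, 0 ≤ c ∧ ∀ x, ‖g1 x‖ ≤ c * Z x ^ (1 - δ)) ∧
      (∀ δ : ℝ, 0 < δ → ∃ c : ℝ, 0 ≤ c ∧ ∀ x, ‖g2 x‖ ≤ c * Z x ^ (1 - δ))) :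
    (∀ x, HasFDerivAt (fun x => f x + g x) (f1 x + g1 x) x) ∧
    (∀ x, HasFDerivAt (fun x => f1 x + g1 x) (f2 x + g2 x) x) ∧
    (∀ δ : ℝ, 0 < δ → ∃ c : ℝ, 0 ≤ c ∧ ∀ x, |f x + g x| ≤ c * Z x ^ (1 - δ)) ∧
    (∀ δ : ℝ, 0 < δ → ∃ c : ℝ, 0 ≤ c ∧ ∀ x, ‖f1 x + g1 x‖ ≤ c * Z x ^ (1 - δ)) ∧
    (∀ δ : ℝ, 0 < δ → ∃ c : ℝ, 0 ≤ c ∧ ∀ x, ‖f2 x + g2 x‖ ≤ c * Z x ^ (1 - δ)) := by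
  obtain ⟨hf1, hf2, hf0b, hf1b, hf2b⟩ := hf
  obtain ⟨hg1, hg2, hg0b, hg1b, hg2b⟩ := hg
  exact ⟨fun x => (hf1 x).add (hg1 x), fun x => (hf2 x).add (hg2 x),
    jet_add hf0b hg0b (fun x => abs_add_le _ _), jet_add hf1b hg1b (fun x => norm_add_le _ _),
    jet_add hf2b hg2b (fun x => norm_add_le _ _)⟩

/-- **Finite sum of tame packs.** [cite: Rudin1976, Thm 5.3] -/
theorem tpack_sum {ι : Type*} (S : Finset ι) {F : ι → EuclideanSpace ℝ (Fin N) → ℝ}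
    {F1 : ι → EuclideanSpace ℝ (Fin N) → EuclideanSpace ℝ (Fin N) →L[ℝ] ℝ}
    {F2 : ι → EuclideanSpace ℝ (Fin N) → EuclideanSpace ℝ (Fin N) →L[ℝ] EuclideanSpace ℝ (Fin N) →L[ℝ] ℝ}
    (h : ∀ i ∈ S, (∀ x, HasFDerivAt (F i) (F1 i x) x) ∧ (∀ x, HasFDerivAt (F1 i) (F2 i x) x) ∧
      (∀ δ : ℝ, 0 < δ → ∃ c : ℝ, 0 ≤ c ∧ ∀ x, |F i x| ≤ c * Z x ^ (-δ)) ∧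
      (∀ δ : ℝ, 0 < δ → ∃ c : ℝ, 0 ≤ c ∧ ∀ x, ‖F1 i x‖ ≤ c * Z x ^ (-δ)) ∧
      (∀ δ : ℝ, 0 < δ → ∃ c : ℝ, 0 ≤ c ∧ ∀ x, ‖F2 i x‖ ≤ c * Z x ^ (-δ))) :
    (∀ x, HasFDerivAt (fun x => ∑ i ∈ S, F i x) (∑ i ∈ S, F1 i x) x) ∧
    (∀ x, HasFDerivAt (fun x => ∑ i ∈ S, F1 i x) (∑ i ∈ S, F2 i x) x) ∧
    (∀ δ : ℝ, 0 < δ → ∃ c : ℝ, 0 ≤ c ∧ ∀ x, |∑ i ∈ S, F i x| ≤ c * Z x ^ (-δ)) ∧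
    (∀ δ : ℝ, 0 < δ → ∃ c : ℝ, 0 ≤ c ∧ ∀ x, ‖∑ i ∈ S, F1 i x‖ ≤ c * Z x ^ (-δ)) ∧
    (∀ δ : ℝ, 0 < δ → ∃ c : ℝ, 0 ≤ c ∧ ∀ x, ‖∑ i ∈ S, F2 i x‖ ≤ c * Z x ^ (-δ)) := by
  refine ⟨fun x => HasFDerivAt.fun_sum fun i hi => (h i hi).1 x,
    fun x => HasFDerivAt.fun_sum fun i hi => (h i hi).2.1 x,
    tame_mono (tame_sum S fun i hi => (h i hi).2.2.1) (fun x => Finset.abs_sum_le_sum_abs _ _),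
    tame_mono (tame_sum S fun i hi => (h i hi).2.2.2.1) (fun x => norm_sum_le _ _),
    tame_mono (tame_sum S fun i hi => (h i hi).2.2.2.2) (fun x => norm_sum_le _ _)⟩

/-- **Finite sum of jet packs.** [cite: Rudin1976, Thm 5.3] -/
theorem jpack_sum {ι : Type*} (S : Finset ι) {F : ι → EuclideanSpace ℝ (Fin N) → ℝ}
    {F1 : ι → EuclideanSpace ℝ (Fin N) → EuclideanSpace ℝ (Fin N) →L[ℝ] ℝ}
    {F2 : ι → EuclideanSpace ℝ (Fin N) → EuclideanSpace ℝ (Fin N) →L[ℝ] EuclideanSpace ℝ (Fin N) →L[ℝ] ℝ}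
    (h : ∀ i ∈ S, (∀ x, HasFDerivAt (F i) (F1 i x) x) ∧ (∀ x, HasFDerivAt (F1 i) (F2 i x) x) ∧
      (∀ δ : ℝ, 0 < δ → ∃ c : ℝ, 0 ≤ c ∧ ∀ x, |F i x| ≤ c * Z x ^ (1 - δ)) ∧
      (∀ δ : ℝ, 0 < δ → ∃ c : ℝ, 0 ≤ c ∧ ∀ x, ‖F1 i x‖ ≤ c * Z x ^ (1 - δ)) ∧
      (∀ δ : ℝ, 0 < δ → ∃ c : ℝ, 0 ≤ c ∧ ∀ x, ‖F2 i x‖ ≤ c * Z x ^ (1 - δ))) :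
    (∀ x, HasFDerivAt (fun x => ∑ i ∈ S, F i x) (∑ i ∈ S, F1 i x) x) ∧
    (∀ x, HasFDerivAt (fun x => ∑ i ∈ S, F1 i x) (∑ i ∈ S, F2 i x) x) ∧
    (∀ δ : ℝ, 0 < δ → ∃ c : ℝ, 0 ≤ c ∧ ∀ x, |∑ i ∈ S, F i x| ≤ c * Z x ^ (1 - δ)) ∧
    (∀ δ : ℝ, 0 < δ → ∃ c : ℝ, 0 ≤ c ∧ ∀ x, ‖∑ i ∈ S, F1 i x‖ ≤ c * Z x ^ (1 - δ)) ∧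
    (∀ δ : ℝ, 0 < δ → ∃ c : ℝ, 0 ≤ c ∧ ∀ x, ‖∑ i ∈ S, F2 i x‖ ≤ c * Z x ^ (1 - δ)) := by
  refine ⟨fun x => HasFDerivAt.fun_sum fun i hi => (h i hi).1 x,
    fun x => HasFDerivAt.fun_sum fun i hi => (h i hi).2.1 x,
    jet_mono (jet_sum S fun i hi => (h i hi).2.2.1) (fun x => Finset.abs_sum_le_sum_abs _ _),
    jet_mono (jet_sum S fun i hi => (h i hi).2.2.2.1) (fun x => norm_sum_le _ _),
    jet_mono (jet_sum S fun i hi => (h i hi).2.2.2.2) (fun x => norm_sum_le _ _)⟩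

end Packs


/-! #### The tame packs of `u = W/Z`, `g_k = ∂_k u`, `A = (∇u)²_Ċ`, `H = (∇√u)²_Ċ` (no lower bound on `Z`) -/

section Quotients

variable {Z W : EuclideanSpace ℝ (Fin N) → ℝ} {K₀ : ℝ}
  {DZ DW : EuclideanSpace ℝ (Fin N) → EuclideanSpace ℝ (Fin N) →L[ℝ] ℝ}
  {D2Z D2W : EuclideanSpace ℝ (Fin N) → EuclideanSpace ℝ (Fin N) →L[ℝ] EuclideanSpace ℝ (Fin N) →L[ℝ] ℝ}

/-- **Tame jets of the quotient `u = W/Z = P_{0,t}F`** from jet packs of `Z > 0` and `W` (no lower bound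
on `Z`): a tame pack with `∂_v u = ∂_vW/Z − W∂_vZ/Z²` and the explicit second derivative
([BBD] proof of Prop 8, `P_{0,t}F = W_t/Z_t`). [cite: BauerschmidtBodineauDagallier2023, Proposition 8 (proof)] -/
theorem quotient_tjets (hZ : ∀ x, 0 < Z x)
    (pZ : (∀ x, HasFDerivAt Z (DZ x) x) ∧ (∀ x, HasFDerivAt DZ (D2Z x) x) ∧
      (∀ δ : ℝ, 0 < δ → ∃ c : ℝ, 0 ≤ c ∧ ∀ x, |Z x| ≤ c * Z x ^ (1 - δ)) ∧
      (∀ δ : ℝ, 0 < δ → ∃ c : ℝ, 0 ≤ c ∧ ∀ x, ‖DZ x‖ ≤ c * Z x ^ (1 - δ)) ∧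
      (∀ δ : ℝ, 0 < δ → ∃ c : ℝ, 0 ≤ c ∧ ∀ x, ‖D2Z x‖ ≤ c * Z x ^ (1 - δ)))
    (pW : (∀ x, HasFDerivAt W (DW x) x) ∧ (∀ x, HasFDerivAt DW (D2W x) x) ∧
      (∀ δ : ℝ, 0 < δ → ∃ c : ℝ, 0 ≤ c ∧ ∀ x, |W x| ≤ c * Z x ^ (1 - δ)) ∧
      (∀ δ : ℝ, 0 < δ → ∃ c : ℝ, 0 ≤ c ∧ ∀ x, ‖DW x‖ ≤ c * Z x ^ (1 - δ)) ∧
      (∀ δ : ℝ, 0 < δ → ∃ c : ℝ, 0 ≤ c ∧ ∀ x, ‖D2W x‖ ≤ c * Z x ^ (1 - δ)))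
    (u : EuclideanSpace ℝ (Fin N) → ℝ) (hu : ∀ x, u x = W x * (Z x)⁻¹) :
    ∃ (Du : EuclideanSpace ℝ (Fin N) → EuclideanSpace ℝ (Fin N) →L[ℝ] ℝ)
      (D2u : EuclideanSpace ℝ (Fin N) → EuclideanSpace ℝ (Fin N) →L[ℝ] EuclideanSpace ℝ (Fin N) →L[ℝ] ℝ),
      ((∀ x, HasFDerivAt u (Du x) x) ∧ (∀ x, HasFDerivAt Du (D2u x) x) ∧
        (∀ δ : ℝ, 0 < δ → ∃ c : ℝ, 0 ≤ c ∧ ∀ x, |u x| ≤ c * Z x ^ (-δ)) ∧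
        (∀ δ : ℝ, 0 < δ → ∃ c : ℝ, 0 ≤ c ∧ ∀ x, ‖Du x‖ ≤ c * Z x ^ (-δ)) ∧
        (∀ δ : ℝ, 0 < δ → ∃ c : ℝ, 0 ≤ c ∧ ∀ x, ‖D2u x‖ ≤ c * Z x ^ (-δ))) ∧
      (∀ x v, Du x v = DW x v / Z x - W x * DZ x v / Z x ^ 2) ∧
      (∀ x v w, D2u x v w = D2W x v w / Z x - DW x v * DZ x w / Z x ^ 2 - DW x w * DZ x v / Z x ^ 2
        - W x * D2Z x v w / Z x ^ 2 + 2 * W x * DZ x w * DZ x v / Z x ^ 3) := by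
  have hu' : u = fun x => W x * (Z x)⁻¹ := funext hu
  subst hu'
  have pu := tpack_of_jpack_div hZ ⟨pZ.1, pZ.2.1, pZ.2.2.2.1, pZ.2.2.2.2⟩ pW
  refine ⟨_, _, pu, fun x v => ?_, fun x v w => ?_⟩
  · have hZx : Z x ≠ 0 := (hZ x).ne'
    simp only [_root_.add_apply, _root_.smul_apply, smul_eq_mul]
    field_simp
    ring
  · have hZx : Z x ≠ 0 := (hZ x).ne'
    simp only [_root_.add_apply, _root_.smul_apply,
      ContinuousLinearMap.smulRight_apply, smul_eq_mul]
    field_simp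
    ring

/-- **Tame jets of the gradient `g_k = ∂_k(W/Z) = W₁ₖ/Z − (W/Z)(Z₁ₖ/Z)`** from jet packs of the atoms
`Z, W, Z₁ₖ, W₁ₖ` (no lower bound on `Z`), with the explicit first and second derivatives (the third-order
jets entering [BBD] Lemma 1). [cite: BauerschmidtBodineauDagallier2023, Lemma 1 (proof)] -/
theorem gradQuotient_tjets (hZ : ∀ x, 0 < Z x)
    (pZ : (∀ x, HasFDerivAt Z (DZ x) x) ∧ (∀ x, HasFDerivAt DZ (D2Z x) x) ∧
      (∀ δ : ℝ, 0 < δ → ∃ c : ℝ, 0 ≤ c ∧ ∀ x, |Z x| ≤ c * Z x ^ (1 - δ)) ∧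
      (∀ δ : ℝ, 0 < δ → ∃ c : ℝ, 0 ≤ c ∧ ∀ x, ‖DZ x‖ ≤ c * Z x ^ (1 - δ)) ∧
      (∀ δ : ℝ, 0 < δ → ∃ c : ℝ, 0 ≤ c ∧ ∀ x, ‖D2Z x‖ ≤ c * Z x ^ (1 - δ)))
    (pW : (∀ x, HasFDerivAt W (DW x) x) ∧ (∀ x, HasFDerivAt DW (D2W x) x) ∧
      (∀ δ : ℝ, 0 < δ → ∃ c : ℝ, 0 ≤ c ∧ ∀ x, |W x| ≤ c * Z x ^ (1 - δ)) ∧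
      (∀ δ : ℝ, 0 < δ → ∃ c : ℝ, 0 ≤ c ∧ ∀ x, ‖DW x‖ ≤ c * Z x ^ (1 - δ)) ∧
      (∀ δ : ℝ, 0 < δ → ∃ c : ℝ, 0 ≤ c ∧ ∀ x, ‖D2W x‖ ≤ c * Z x ^ (1 - δ)))
    {Z1k W1k : EuclideanSpace ℝ (Fin N) → ℝ}
    {DZ1k DW1k : EuclideanSpace ℝ (Fin N) → EuclideanSpace ℝ (Fin N) →L[ℝ] ℝ}
    {D2Z1k D2W1k : EuclideanSpace ℝ (Fin N) →
      EuclideanSpace ℝ (Fin N) →L[ℝ] EuclideanSpace ℝ (Fin N) →L[ℝ] ℝ}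
    (pZ1 : (∀ x, HasFDerivAt Z1k (DZ1k x) x) ∧ (∀ x, HasFDerivAt DZ1k (D2Z1k x) x) ∧
      (∀ δ : ℝ, 0 < δ → ∃ c : ℝ, 0 ≤ c ∧ ∀ x, |Z1k x| ≤ c * Z x ^ (1 - δ)) ∧
      (∀ δ : ℝ, 0 < δ → ∃ c : ℝ, 0 ≤ c ∧ ∀ x, ‖DZ1k x‖ ≤ c * Z x ^ (1 - δ)) ∧
      (∀ δ : ℝ, 0 < δ → ∃ c : ℝ, 0 ≤ c ∧ ∀ x, ‖D2Z1k x‖ ≤ c * Z x ^ (1 - δ)))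
    (pW1 : (∀ x, HasFDerivAt W1k (DW1k x) x) ∧ (∀ x, HasFDerivAt DW1k (D2W1k x) x) ∧
      (∀ δ : ℝ, 0 < δ → ∃ c : ℝ, 0 ≤ c ∧ ∀ x, |W1k x| ≤ c * Z x ^ (1 - δ)) ∧
      (∀ δ : ℝ, 0 < δ → ∃ c : ℝ, 0 ≤ c ∧ ∀ x, ‖DW1k x‖ ≤ c * Z x ^ (1 - δ)) ∧
      (∀ δ : ℝ, 0 < δ → ∃ c : ℝ, 0 ≤ c ∧ ∀ x, ‖D2W1k x‖ ≤ c * Z x ^ (1 - δ)))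
    (gk : EuclideanSpace ℝ (Fin N) → ℝ)
    (hg : ∀ x, gk x = W1k x * (Z x)⁻¹ - W x * (Z x)⁻¹ * (Z1k x * (Z x)⁻¹)) :
    ∃ (Dg : EuclideanSpace ℝ (Fin N) → EuclideanSpace ℝ (Fin N) →L[ℝ] ℝ)
      (D2g : EuclideanSpace ℝ (Fin N) → EuclideanSpace ℝ (Fin N) →L[ℝ] EuclideanSpace ℝ (Fin N) →L[ℝ] ℝ),
      ((∀ x, HasFDerivAt gk (Dg x) x) ∧ (∀ x, HasFDerivAt Dg (D2g x) x) ∧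
        (∀ δ : ℝ, 0 < δ → ∃ c : ℝ, 0 ≤ c ∧ ∀ x, |gk x| ≤ c * Z x ^ (-δ)) ∧
        (∀ δ : ℝ, 0 < δ → ∃ c : ℝ, 0 ≤ c ∧ ∀ x, ‖Dg x‖ ≤ c * Z x ^ (-δ)) ∧
        (∀ δ : ℝ, 0 < δ → ∃ c : ℝ, 0 ≤ c ∧ ∀ x, ‖D2g x‖ ≤ c * Z x ^ (-δ))) ∧
      (∀ x v, Dg x v = DW1k x v / Z x - W1k x * DZ x v / Z x ^ 2 - DW x v * Z1k x / Z x ^ 2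
        - W x * DZ1k x v / Z x ^ 2 + 2 * W x * Z1k x * DZ x v / Z x ^ 3) ∧
      (∀ x v w, D2g x v w =
        D2W1k x v w / Z x - DW1k x v * DZ x w / Z x ^ 2 - DW1k x w * DZ x v / Z x ^ 2
        - W1k x * D2Z x v w / Z x ^ 2 + 2 * W1k x * DZ x v * DZ x w / Z x ^ 3
        - D2W x v w * Z1k x / Z x ^ 2 - DW x v * DZ1k x w / Z x ^ 2 + 2 * DW x v * Z1k x * DZ x w / Z x ^ 3
        - DW x w * DZ1k x v / Z x ^ 2 - W x * D2Z1k x v w / Z x ^ 2 + 2 * W x * DZ1k x v * DZ x w / Z x ^ 3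
        + 2 * DW x w * Z1k x * DZ x v / Z x ^ 3 + 2 * W x * DZ1k x w * DZ x v / Z x ^ 3
        + 2 * W x * Z1k x * D2Z x v w / Z x ^ 3 - 6 * W x * Z1k x * DZ x v * DZ x w / Z x ^ 4) := by
  have hg' : gk = fun x => W1k x * (Z x)⁻¹ - W x * (Z x)⁻¹ * (Z1k x * (Z x)⁻¹) := funext hg
  subst hg'
  have hZp : (∀ x, HasFDerivAt Z (DZ x) x) ∧ (∀ x, HasFDerivAt DZ (D2Z x) x) ∧
      (∀ δ : ℝ, 0 < δ → ∃ c : ℝ, 0 ≤ c ∧ ∀ x, ‖DZ x‖ ≤ c * Z x ^ (1 - δ)) ∧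
      (∀ δ : ℝ, 0 < δ → ∃ c : ℝ, 0 ≤ c ∧ ∀ x, ‖D2Z x‖ ≤ c * Z x ^ (1 - δ)) :=
    ⟨pZ.1, pZ.2.1, pZ.2.2.2.1, pZ.2.2.2.2⟩
  have pg := tpack_sub (tpack_of_jpack_div hZ hZp pW1)
    (tpack_mul hZ (tpack_of_jpack_div hZ hZp pW) (tpack_of_jpack_div hZ hZp pZ1))
  refine ⟨_, _, pg, fun x v => ?_, fun x v w => ?_⟩
  · have hZx : Z x ≠ 0 := (hZ x).ne'
    simp only [_root_.add_apply, _root_.sub_apply, _root_.smul_apply, smul_eq_mul]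
    field_simp
    ring
  · have hZx : Z x ≠ 0 := (hZ x).ne'
    simp only [_root_.add_apply, _root_.sub_apply, _root_.smul_apply,
      ContinuousLinearMap.smulRight_apply, smul_eq_mul]
    field_simp
    ring

/-- **Tame jets of the quadratic form `A = Σ_{kl} Ċ^{kl} g_k g_l = (∇u)²_{Ċ}`** from tame packs of the
`g_k`. [cite: BauerschmidtBodineauDagallier2023, Lemma 1 (proof)] -/
theorem quadForm_tjets (hZ : ∀ x, 0 < Z x) {g : Fin N → EuclideanSpace ℝ (Fin N) → ℝ}
    {Dg : Fin N → EuclideanSpace ℝ (Fin N) → EuclideanSpace ℝ (Fin N) →L[ℝ] ℝ}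
    {D2g : Fin N → EuclideanSpace ℝ (Fin N) →
      EuclideanSpace ℝ (Fin N) →L[ℝ] EuclideanSpace ℝ (Fin N) →L[ℝ] ℝ}
    (pg : ∀ k, (∀ x, HasFDerivAt (g k) (Dg k x) x) ∧ (∀ x, HasFDerivAt (Dg k) (D2g k x) x) ∧
      (∀ δ : ℝ, 0 < δ → ∃ c : ℝ, 0 ≤ c ∧ ∀ x, |g k x| ≤ c * Z x ^ (-δ)) ∧
      (∀ δ : ℝ, 0 < δ → ∃ c : ℝ, 0 ≤ c ∧ ∀ x, ‖Dg k x‖ ≤ c * Z x ^ (-δ)) ∧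
      (∀ δ : ℝ, 0 < δ → ∃ c : ℝ, 0 ≤ c ∧ ∀ x, ‖D2g k x‖ ≤ c * Z x ^ (-δ)))
    (C : Matrix (Fin N) (Fin N) ℝ)
    (A : EuclideanSpace ℝ (Fin N) → ℝ) (hA : ∀ x, A x = ∑ k, ∑ l, C k l * (g k x * g l x)) :
    ∃ (DA : EuclideanSpace ℝ (Fin N) → EuclideanSpace ℝ (Fin N) →L[ℝ] ℝ)
      (D2A : EuclideanSpace ℝ (Fin N) → EuclideanSpace ℝ (Fin N) →L[ℝ] EuclideanSpace ℝ (Fin N) →L[ℝ] ℝ),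
      ((∀ x, HasFDerivAt A (DA x) x) ∧ (∀ x, HasFDerivAt DA (D2A x) x) ∧
        (∀ δ : ℝ, 0 < δ → ∃ c : ℝ, 0 ≤ c ∧ ∀ x, |A x| ≤ c * Z x ^ (-δ)) ∧
        (∀ δ : ℝ, 0 < δ → ∃ c : ℝ, 0 ≤ c ∧ ∀ x, ‖DA x‖ ≤ c * Z x ^ (-δ)) ∧
        (∀ δ : ℝ, 0 < δ → ∃ c : ℝ, 0 ≤ c ∧ ∀ x, ‖D2A x‖ ≤ c * Z x ^ (-δ))) ∧
      (∀ x v, DA x v = ∑ k, ∑ l, C k l * (g k x * Dg l x v + g l x * Dg k x v)) ∧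
      (∀ x v w, D2A x v w = ∑ k, ∑ l, C k l *
        (g k x * D2g l x v w + Dg k x v * Dg l x w + (g l x * D2g k x v w + Dg l x v * Dg k x w))) := by
  have hA' : A = fun x => ∑ k, ∑ l, C k l * (g k x * g l x) := funext hA
  subst hA'
  have hkl := fun k l => tpack_const_mul (C k l) (tpack_mul hZ (pg k) (pg l))
  have inner := fun k => tpack_sum Finset.univ (fun l _ => hkl k l)
  have outer := tpack_sum Finset.univ (fun k _ => inner k)
  refine ⟨_, _, outer, fun x v => ?_, fun x v w => ?_⟩
  · simp only [_root_.sum_apply, _root_.add_apply, _root_.smul_apply, smul_eq_mul]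
  · simp only [_root_.sum_apply, _root_.add_apply, _root_.smul_apply,
      ContinuousLinearMap.smulRight_apply, smul_eq_mul]

/-- **Tame jets of `H = A/(4u) = (∇√u)²_{Ċ}`** from tame packs of `A` and of `u ≥ a > 0`.
[cite: BauerschmidtBodineauDagallier2023, Lemma 1 (proof)] -/
theorem sqrtEnergy_tjets (hZ : ∀ x, 0 < Z x) (hZK : ∀ x, Z x ≤ K₀) {u A : EuclideanSpace ℝ (Fin N) → ℝ}
    {Du DA : EuclideanSpace ℝ (Fin N) → EuclideanSpace ℝ (Fin N) →L[ℝ] ℝ}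
    {D2u D2A : EuclideanSpace ℝ (Fin N) → EuclideanSpace ℝ (Fin N) →L[ℝ] EuclideanSpace ℝ (Fin N) →L[ℝ] ℝ}
    (pu : (∀ x, HasFDerivAt u (Du x) x) ∧ (∀ x, HasFDerivAt Du (D2u x) x) ∧
      (∀ δ : ℝ, 0 < δ → ∃ c : ℝ, 0 ≤ c ∧ ∀ x, |u x| ≤ c * Z x ^ (-δ)) ∧
      (∀ δ : ℝ, 0 < δ → ∃ c : ℝ, 0 ≤ c ∧ ∀ x, ‖Du x‖ ≤ c * Z x ^ (-δ)) ∧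
      (∀ δ : ℝ, 0 < δ → ∃ c : ℝ, 0 ≤ c ∧ ∀ x, ‖D2u x‖ ≤ c * Z x ^ (-δ)))
    (pA : (∀ x, HasFDerivAt A (DA x) x) ∧ (∀ x, HasFDerivAt DA (D2A x) x) ∧
      (∀ δ : ℝ, 0 < δ → ∃ c : ℝ, 0 ≤ c ∧ ∀ x, |A x| ≤ c * Z x ^ (-δ)) ∧
      (∀ δ : ℝ, 0 < δ → ∃ c : ℝ, 0 ≤ c ∧ ∀ x, ‖DA x‖ ≤ c * Z x ^ (-δ)) ∧
      (∀ δ : ℝ, 0 < δ → ∃ c : ℝ, 0 ≤ c ∧ ∀ x, ‖D2A x‖ ≤ c * Z x ^ (-δ)))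
    {a : ℝ} (ha : 0 < a) (hau : ∀ x, a ≤ u x)
    (H : EuclideanSpace ℝ (Fin N) → ℝ) (hH : ∀ x, H x = (1 / 4) * (A x * (u x)⁻¹)) :
    ∃ (DH : EuclideanSpace ℝ (Fin N) → EuclideanSpace ℝ (Fin N) →L[ℝ] ℝ)
      (D2H : EuclideanSpace ℝ (Fin N) → EuclideanSpace ℝ (Fin N) →L[ℝ] EuclideanSpace ℝ (Fin N) →L[ℝ] ℝ),
      ((∀ x, HasFDerivAt H (DH x) x) ∧ (∀ x, HasFDerivAt DH (D2H x) x) ∧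
        (∀ δ : ℝ, 0 < δ → ∃ c : ℝ, 0 ≤ c ∧ ∀ x, |H x| ≤ c * Z x ^ (-δ)) ∧
        (∀ δ : ℝ, 0 < δ → ∃ c : ℝ, 0 ≤ c ∧ ∀ x, ‖DH x‖ ≤ c * Z x ^ (-δ)) ∧
        (∀ δ : ℝ, 0 < δ → ∃ c : ℝ, 0 ≤ c ∧ ∀ x, ‖D2H x‖ ≤ c * Z x ^ (-δ))) ∧
      (∀ x v, DH x v = DA x v / (4 * u x) - A x * Du x v / (4 * u x ^ 2)) ∧
      (∀ x v w, D2H x v w = D2A x v w / (4 * u x) - (DA x w * Du x v + DA x v * Du x w) / (4 * u x ^ 2)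
        - A x * D2u x v w / (4 * u x ^ 2) + 2 * A x * (Du x v * Du x w) / (4 * u x ^ 3)) := by
  have hH' : H = fun x => (1 / 4) * (A x * (u x)⁻¹) := funext hH
  subst hH'
  have pH := tpack_const_mul (1 / 4 : ℝ) (tpack_mul hZ pA (tpack_inv hZ hZK pu ha hau))
  refine ⟨_, _, pH, fun x v => ?_, fun x v w => ?_⟩
  · have hux : u x ≠ 0 := (ha.trans_le (hau x)).ne'
    simp only [_root_.add_apply, _root_.smul_apply, smul_eq_mul]
    field_simp
    ring
  · have hux : u x ≠ 0 := (ha.trans_le (hau x)).ne'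
    simp only [_root_.add_apply, _root_.smul_apply,
      ContinuousLinearMap.smulRight_apply, smul_eq_mul]
    field_simp
    ring

end Quotients

end Polchinski

end Literature.Analysis.FunctionSpaces

end
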